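import Mathlib.NumberTheory.NumberField.Basic
import Mathlib.NumberTheory.NumberField.Discriminant.Basic
import Mathlib.NumberTheory.NumberField.Ideal.KummerDedekind
import Mathlib.RingTheory.Discriminant
import Mathlib.RingTheory.Polynomial.Eisenstein.IsIntegral
import Mathlib.RingTheory.Adjoin.PowerBasis
import Mathlib.FieldTheory.Minpoly.IsIntegrallyClosed
import Mathlib.Algebra.Polynomial.SpecificDegree
import Mathlib.Algebra.Polynomial.Eval.Irreducible
import Mathlib.FieldTheory.Galois.Basic
import Mathlib.NumberTheory.NumberField.Units.DirichletTheorem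
import Mathlib.Topology.Algebra.Polynomial
import Mathlib.Analysis.SpecialFunctions.Pow.Real
import Mathlib.Data.Sign.Basic
import Mathlib.Tactic.NormNum.Prime
import HarnessLib

/-!
# The cyclic cubic field of conductor `103`: `K = ℚ(θ)`, `θ³ + θ² - 34θ - 61 = 0`

Explicit arithmetic of the cubic subfield `K` of `ℚ(ζ₁₀₃)` (`[ℚ(ζ₁₀₃) : K] = 34`; `θ` is a
Gaussian period of length `34`), the second of the four cubic subfields of the field `F₃` of
T. Dokchitser–V. Dokchitser, *A note on the Mordell–Weil rank modulo `n`* (2011), proof of Thm. 2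
(the conductor-`13` subfield is `CyclicCubicField13.lean`, whose plan this file follows). The
field is NOT monogenic for `θ` (`disc(1, θ, θ²) = 9 · 103²`, `[𝓞 K : ℤ[θ]] = 3`); everything is
proved:

* `K = ℚ[X]/(f)`, `f = X³ + X² - 34X - 61` irreducible; `θ`, the norm and trace forms on
  `1, θ, θ²` (`norm_quadratic`, `trace_quadratic`), `disc(1, θ, θ²) = 95481 = 9 · 103²`;
* **`𝓞 K = ℤ ⊕ ℤθ ⊕ ℤω`, `ω = (θ² - 1)/3`** (`exists_int_coords`): `ω` is integral
  (`ω³ - 22ω² + 127ω - 93 = 0`); conversely, for `z ∈ 𝓞 K`, `9 · 103² z ∈ ℤ[θ]`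
  (`Algebra.discr_mul_isIntegral_mem_adjoin`), the `103`-part is removed by Eisenstein's criterion
  for `f(X + 34) = X³ + 103X² + 3502X + 39243` at `103`
  (`mem_adjoin_of_smul_prime_pow_smul_of_minpoly_isEisensteinAt`, as for cyclotomic integers in
  Mathlib), and `9z ∈ ℤ[θ]` together with `Tr(z), Tr(zθ), Tr(zω) ∈ ℤ` forces integer coordinates
  on `1, θ, ω` (linear congruences, `omega`);
* the units `u₁ = -2 + 3θ + 2ω`, `u₂ = 49 + 2θ - 5ω` (`= σu₁`) of norm `1` with their inverses;
* `Gal(K/ℚ) = ⟨σ⟩ ≅ C₃`, `σθ = (22 - θ²)/3 = 7 - ω`; `K/ℚ` is Galois; `N(x) = x σx σ²x`;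
* the three real embeddings (roots in `(-6,-5)`, `(-2,-1)`, `(6,7)`), the sign vectors
  `sgn(-1) = (-,-,-)`, `sgn u₁ = (-,-,+)`, `sgn u₂ = (-,+,-)` — a basis of `{±1}³` — and hence
  (Dirichlet: rank `≤ 2`) **`(𝓞 K)ˣ/(𝓞 K)ˣ² = {±u₁^i u₂^j}`** and totally positive units are squares
  (`exists_eq_rep_mul_sq`, `exists_sq_eq_of_pos`).

## References

* T. Dokchitser, V. Dokchitser, *A note on the Mordell–Weil rank modulo `n`*, J. Number Theory
  131 (2011) 1833–1839: proof of Thm. 2. [DokchitserDokchitser2011RankModN]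
* D. A. Marcus, *Number Fields*, 2nd ed. (2018), Ch. 2 (integral bases, discriminants, Thm. 12 and
  Ex. 27), Ch. 5 (Dirichlet). [Marcus2018]
-/

noncomputable section

open Polynomial NumberField Algebra

namespace Literature.NumberTheory.NumberFields

namespace CyclicCubic103

/-! ### The polynomial `f = X³ + X² - 34X - 61` -/

/-- `f = X³ + X² - 34X - 61 ∈ ℤ[X]`, the defining polynomial of the cubic subfield of `ℚ(ζ₁₀₃)`
(minimal polynomial of the Gaussian periods of length `34`). [folklore] -/
abbrev cubicPoly : ℤ[X] := X ^ 3 + X ^ 2 - C 34 * X - C 61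

/-- `f ∈ ℚ[X]`. [folklore] -/
abbrev cubicPolyRat : ℚ[X] := cubicPoly.map (algebraMap ℤ ℚ)

/-- `cubicPolyRat = X³ + X² - 34X - 61`. [folklore] -/
theorem cubicPolyRat_eq : cubicPolyRat = X ^ 3 + X ^ 2 - C 34 * X - C 61 := by
  rw [cubicPolyRat, cubicPoly, Polynomial.map_sub, Polynomial.map_sub, Polynomial.map_add,
    Polynomial.map_pow, Polynomial.map_pow, map_X, Polynomial.map_mul, Polynomial.map_C,
    Polynomial.map_C, map_X]
  norm_num

/-- `f` is monic. [folklore] -/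
theorem cubicPoly_monic : cubicPoly.Monic := by
  unfold cubicPoly
  monicity!

/-- `deg f = 3`. [folklore] -/
theorem cubicPoly_natDegree : cubicPoly.natDegree = 3 := by
  unfold cubicPoly
  compute_degree!

/-- `f mod 2 = X³ + X² + 1` has no root in `𝔽₂`, hence is irreducible. [folklore] -/
theorem irreducible_map_zmod_two : Irreducible (cubicPoly.map (Int.castRingHom (ZMod 2))) := by
  refine irreducible_of_degree_le_three_of_not_isRoot ?_ fun x => ?_
  · rw [cubicPoly_monic.natDegree_map, cubicPoly_natDegree]
    decide
  · fin_cases x <;>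
      simp only [cubicPoly, Polynomial.map_add, Polynomial.map_sub, Polynomial.map_pow, map_X,
        Polynomial.map_mul, Polynomial.map_C, IsRoot.def, eval_add, eval_sub, eval_mul, eval_pow,
        eval_X, eval_C] <;>
      decide

/-- `f` is irreducible over `ℤ`. [folklore] -/
theorem cubicPoly_irreducible : Irreducible cubicPoly :=
  cubicPoly_monic.irreducible_of_irreducible_map _ _ irreducible_map_zmod_two

/-- `f` is irreducible over `ℚ` (Gauss). [folklore] -/
theorem cubicPolyRat_irreducible : Irreducible cubicPolyRat :=
  cubicPoly_monic.irreducible_iff_irreducible_map_fraction_map.mp cubicPoly_irreducible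

/-- Irreducibility as a `Fact` (so that `AdjoinRoot cubicPolyRat` is a field). [folklore] -/
instance : Fact (Irreducible cubicPolyRat) := ⟨cubicPolyRat_irreducible⟩

/-- `f ≠ 0` in `ℚ[X]`. [folklore] -/
theorem cubicPolyRat_ne_zero : cubicPolyRat ≠ 0 := cubicPolyRat_irreducible.ne_zero

/-- `cubicPolyRat` is monic. [folklore] -/
theorem cubicPolyRat_monic : cubicPolyRat.Monic := cubicPoly_monic.map _

/-- `deg cubicPolyRat = 3`. [folklore] -/
theorem cubicPolyRat_natDegree : cubicPolyRat.natDegree = 3 := by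
  show (cubicPoly.map (algebraMap ℤ ℚ)).natDegree = 3
  rw [cubicPoly_monic.natDegree_map, cubicPoly_natDegree]

/-! ### The field `K = ℚ[X]/(f)` and its generator `θ` -/

/-- **The cyclic cubic field of conductor `103`**, `K = ℚ[X]/(X³ + X² - 34X - 61)`. [folklore] -/
abbrev K : Type := AdjoinRoot cubicPolyRat

/-- `K` is a number field. [folklore] -/
instance : NumberField K := by unfold K; infer_instance

/-- `θ ∈ K`, the class of `X`. [folklore] -/
def θ : K := AdjoinRoot.root cubicPolyRat

/-- The cubic relation `θ³ = -θ² + 34θ + 61`. [folklore] -/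
theorem θ_pow_three : θ ^ 3 = -θ ^ 2 + 34 * θ + 61 := by
  have h : eval₂ (AdjoinRoot.of cubicPolyRat) (AdjoinRoot.root cubicPolyRat) cubicPolyRat = 0 :=
    AdjoinRoot.eval₂_root cubicPolyRat
  rw [eval₂_map, cubicPoly, eval₂_sub, eval₂_sub, eval₂_add, eval₂_X_pow, eval₂_X_pow, eval₂_mul,
    eval₂_C, eval₂_X, eval₂_C, map_ofNat, map_ofNat] at h
  change θ ^ 3 + θ ^ 2 - 34 * θ - 61 = 0 at h
  linear_combination h

/-- `θ⁴ = 35θ² + 27θ - 61`. [folklore] -/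
theorem θ_pow_four : θ ^ 4 = 35 * θ ^ 2 + 27 * θ - 61 := by
  have h3 := θ_pow_three
  calc θ ^ 4 = θ * θ ^ 3 := by ring
    _ = _ := by rw [h3]; ring_nf; rw [h3]; ring

/-- `θ⁵ = -8θ² + 1129θ + 2135`. [folklore] -/
theorem θ_pow_five : θ ^ 5 = -8 * θ ^ 2 + 1129 * θ + 2135 := by
  calc θ ^ 5 = θ * θ ^ 4 := by ring
    _ = _ := by rw [θ_pow_four]; ring_nf; rw [θ_pow_three]; ring

/-- `θ⁶ = 1137θ² + 1863θ - 488`. [folklore] -/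
theorem θ_pow_six : θ ^ 6 = 1137 * θ ^ 2 + 1863 * θ - 488 := by
  calc θ ^ 6 = θ * θ ^ 5 := by ring
    _ = _ := by rw [θ_pow_five]; ring_nf; rw [θ_pow_three]; ring

/-- `θ` is a root of `f ∈ ℤ[X]`. [folklore] -/
theorem aeval_θ_cubicPoly : aeval θ cubicPoly = 0 := by
  rw [cubicPoly, map_sub, map_sub, map_add, map_pow, map_pow, map_mul, aeval_C, aeval_X, aeval_C,
    map_ofNat, map_ofNat, θ_pow_three]
  ring

/-- `θ` is a root of `f ∈ ℚ[X]`. [folklore] -/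
theorem aeval_θ : aeval θ cubicPolyRat = 0 :=
  (aeval_map_algebraMap ℚ θ cubicPoly).trans aeval_θ_cubicPoly

/-- `θ` is an algebraic integer. [folklore] -/
theorem isIntegral_θ : IsIntegral ℤ θ := ⟨cubicPoly, cubicPoly_monic, aeval_θ_cubicPoly⟩

/-- `minpoly_ℤ θ = f`. [folklore] -/
theorem minpoly_int_θ : minpoly ℤ θ = cubicPoly :=
  (eq_of_monic_of_associated (minpoly.monic isIntegral_θ) cubicPoly_monic
    ((minpoly.irreducible isIntegral_θ).associated_of_dvd cubicPoly_irreducible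
      (minpoly.isIntegrallyClosed_dvd isIntegral_θ aeval_θ_cubicPoly)))

/-- `minpoly_ℚ θ = f`. [folklore] -/
theorem minpoly_rat_θ : minpoly ℚ θ = X ^ 3 + X ^ 2 - C 34 * X - C 61 := by
  rw [minpoly.isIntegrallyClosed_eq_field_fractions' ℚ isIntegral_θ, minpoly_int_θ]
  exact cubicPolyRat_eq

/-- The power basis `1, θ, θ²` of `K/ℚ`. [folklore] -/
def pbθ : PowerBasis ℚ K := AdjoinRoot.powerBasis cubicPolyRat_ne_zero

/-- The generator of `pbθ` is `θ`. [folklore] -/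
theorem pbθ_gen : pbθ.gen = θ := AdjoinRoot.powerBasis_gen _

/-- `pbθ` has dimension `3`. [folklore] -/
theorem pbθ_dim : pbθ.dim = 3 := by
  rw [pbθ, AdjoinRoot.powerBasis_dim, cubicPolyRat_natDegree]

/-- `[K : ℚ] = 3`. [folklore] -/
theorem finrank_K : Module.finrank ℚ K = 3 := by
  rw [← pbθ_dim, PowerBasis.finrank]

/-- `N_{K/ℚ}(θ) = 61` (`= (-1)³ f(0)`). [folklore] -/
theorem norm_θ : Algebra.norm ℚ θ = 61 := by
  have h := PowerBasis.norm_gen_eq_coeff_zero_minpoly pbθ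
  rw [pbθ_gen, pbθ_dim, minpoly_rat_θ] at h
  rw [h]
  norm_num [coeff_X_pow, coeff_C, coeff_X]

/-! ### Norms and traces of explicit elements: the matrix of multiplication on `1, θ, θ²` -/

/-- `deg_ℚ f = 3` as a `degree`. [folklore] -/
theorem cubicPolyRat_degree : cubicPolyRat.degree = 3 := by
  rw [degree_eq_natDegree cubicPolyRat_ne_zero, cubicPolyRat_natDegree]; rfl

/-- The power basis `1, θ, θ²` in Mathlib's `powerBasis'` form. [folklore] -/
abbrev pbX : PowerBasis ℚ K := AdjoinRoot.powerBasis' cubicPolyRat_monic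

/-- `pbX` has dimension `3`. [folklore] -/
theorem pbX_dim : pbX.dim = 3 := cubicPolyRat_natDegree

/-- Coordinates in `pbX`: the class of `p` has as coordinates the coefficients of `p mod f`.
[folklore] -/
theorem repr_mk (p : ℚ[X]) (i : Fin pbX.dim) :
    pbX.basis.repr (AdjoinRoot.mk cubicPolyRat p) i = (p %ₘ cubicPolyRat).coeff i := by
  change (AdjoinRoot.powerBasisAux' cubicPolyRat_monic).repr _ i = _
  rw [AdjoinRoot.powerBasisAux'_repr_apply_to_fun, AdjoinRoot.modByMonicHom_mk]

/-- Entries of the matrix of multiplication by the class of `p` on `1, θ, θ²`. [folklore] -/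
theorem leftMulMatrix_mk (p : ℚ[X]) (i j : Fin pbX.dim) :
    Algebra.leftMulMatrix pbX.basis (AdjoinRoot.mk cubicPolyRat p) i j =
      ((p * X ^ (j : ℕ)) %ₘ cubicPolyRat).coeff i := by
  rw [Algebra.leftMulMatrix_eq_repr_mul, PowerBasis.basis_eq_pow,
    show pbX.gen = AdjoinRoot.mk cubicPolyRat X from (AdjoinRoot.mk_X).symm, ← map_pow, ← map_mul,
    repr_mk]

/-- Reduction of a polynomial modulo `f` to an explicit quadratic remainder, certified by the
quotient `k`. [folklore] -/
theorem modByMonic_cubicPolyRat_eq {q : ℚ[X]} (a b c : ℚ) (k : ℚ[X])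
    (h : q - (C a * X ^ 2 + C b * X + C c) = cubicPolyRat * k) :
    q %ₘ cubicPolyRat = C a * X ^ 2 + C b * X + C c := by
  rw [modByMonic_eq_of_dvd_sub cubicPolyRat_monic (Dvd.intro _ h.symm),
    modByMonic_eq_self_iff cubicPolyRat_monic, cubicPolyRat_degree]
  exact degree_quadratic_le.trans_lt (by decide)

/-- The three remainders `p, pX, pX² (mod f)` for `p = aX² + bX + c` (using `θ³ = -θ² + 34θ + 61`,
`θ⁴ = 35θ² + 27θ - 61`). [folklore] -/
theorem remainders (a b c : ℚ) :
    (C a * X ^ 2 + C b * X + C c) %ₘ cubicPolyRat = C a * X ^ 2 + C b * X + C c ∧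
    ((C a * X ^ 2 + C b * X + C c) * X) %ₘ cubicPolyRat =
      C (b - a) * X ^ 2 + C (34 * a + c) * X + C (61 * a) ∧
    ((C a * X ^ 2 + C b * X + C c) * X ^ 2) %ₘ cubicPolyRat =
      C (35 * a - b + c) * X ^ 2 + C (27 * a + 34 * b) * X + C (-61 * a + 61 * b) := by
  have h34 : (C 34 : ℚ[X]) = 34 := map_ofNat C 34
  have h61 : (C 61 : ℚ[X]) = 61 := map_ofNat C 61
  have h27 : (C 27 : ℚ[X]) = 27 := map_ofNat C 27
  have h35 : (C 35 : ℚ[X]) = 35 := map_ofNat C 35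
  refine ⟨modByMonic_cubicPolyRat_eq a b c 0 (by ring), ?_, ?_⟩
  · exact modByMonic_cubicPolyRat_eq _ _ _ (C a) (by
      rw [cubicPolyRat_eq]; simp only [C_sub, C_add, C_mul, h34, h61]; ring)
  · exact modByMonic_cubicPolyRat_eq _ _ _ (C a * X + C (b - a)) (by
      rw [cubicPolyRat_eq]; simp only [C_sub, C_add, C_mul, C_neg, h34, h61, h27, h35]; ring)

/-- The entries of the multiplication matrix on the reindexed basis. [folklore] -/
theorem leftMulMatrix_reindex (p : ℚ[X]) (i j : Fin 3) :
    Algebra.leftMulMatrix (pbX.basis.reindex (finCongr pbX_dim)) (AdjoinRoot.mk cubicPolyRat p) i j =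
      ((p * X ^ (j : ℕ)) %ₘ cubicPolyRat).coeff (i : ℕ) := by
  have hv : ∀ j : Fin 3, (((finCongr pbX_dim).symm j : Fin pbX.dim) : ℕ) = (j : ℕ) := fun j => rfl
  rw [Algebra.leftMulMatrix_eq_repr_mul, Module.Basis.reindex_apply,
    Module.Basis.repr_reindex_apply, ← Algebra.leftMulMatrix_eq_repr_mul, leftMulMatrix_mk, hv, hv]

/-- **`N(aθ² + bθ + c)` as the determinant of the multiplication matrix** on `1, θ, θ²`, whose
columns are `(c, b, a)`, `(61a, 34a + c, b - a)`, `(-61a + 61b, 27a + 34b, 35a - b + c)`.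
[folklore] -/
theorem norm_mk_eq (a b c : ℚ) :
    Algebra.norm ℚ (AdjoinRoot.mk cubicPolyRat (C a * X ^ 2 + C b * X + C c)) =
      c * ((34 * a + c) * (35 * a - b + c) - (27 * a + 34 * b) * (b - a))
        - 61 * a * (b * (35 * a - b + c) - (27 * a + 34 * b) * a)
        + (-61 * a + 61 * b) * (b * (b - a) - (34 * a + c) * a) := by
  classical
  set p : ℚ[X] := C a * X ^ 2 + C b * X + C c with hp
  have r0 : p %ₘ cubicPolyRat = C a * X ^ 2 + C b * X + C c := (remainders a b c).1
  have r1 : (p * X) %ₘ cubicPolyRat = C (b - a) * X ^ 2 + C (34 * a + c) * X + C (61 * a) :=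
    (remainders a b c).2.1
  have r2 : (p * X ^ 2) %ₘ cubicPolyRat =
      C (35 * a - b + c) * X ^ 2 + C (27 * a + 34 * b) * X + C (-61 * a + 61 * b) :=
    (remainders a b c).2.2
  have hdet := Algebra.norm_eq_matrix_det (pbX.basis.reindex (finCongr pbX_dim))
    (AdjoinRoot.mk cubicPolyRat p)
  rw [Matrix.det_fin_three] at hdet
  simp only [leftMulMatrix_reindex, Fin.val_zero, Fin.val_one, Fin.val_two, pow_zero, mul_one,
    pow_one, r0, r1, r2, coeff_add, coeff_C_mul, coeff_X_pow, coeff_X, coeff_C] at hdet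
  norm_num at hdet
  rw [hdet]
  ring

/-- **`Tr(aθ² + bθ + c) = 69a - b + 3c`** (trace of the multiplication matrix). [folklore] -/
theorem trace_mk_eq (a b c : ℚ) :
    Algebra.trace ℚ K (AdjoinRoot.mk cubicPolyRat (C a * X ^ 2 + C b * X + C c)) =
      69 * a - b + 3 * c := by
  classical
  set p : ℚ[X] := C a * X ^ 2 + C b * X + C c with hp
  have r0 : p %ₘ cubicPolyRat = C a * X ^ 2 + C b * X + C c := (remainders a b c).1
  have r1 : (p * X) %ₘ cubicPolyRat = C (b - a) * X ^ 2 + C (34 * a + c) * X + C (61 * a) :=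
    (remainders a b c).2.1
  have r2 : (p * X ^ 2) %ₘ cubicPolyRat =
      C (35 * a - b + c) * X ^ 2 + C (27 * a + 34 * b) * X + C (-61 * a + 61 * b) :=
    (remainders a b c).2.2
  have htr := Algebra.trace_eq_matrix_trace (pbX.basis.reindex (finCongr pbX_dim))
    (AdjoinRoot.mk cubicPolyRat p)
  rw [Matrix.trace_fin_three] at htr
  simp only [leftMulMatrix_reindex, Fin.val_zero, Fin.val_one, Fin.val_two, pow_zero, mul_one,
    pow_one, r0, r1, r2, coeff_add, coeff_C_mul, coeff_X_pow, coeff_X, coeff_C] at htr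
  norm_num at htr
  rw [htr]
  ring

/-- The class of `aX² + bX + c` is `aθ² + bθ + c`. [folklore] -/
theorem mk_quadratic (a b c : ℚ) :
    AdjoinRoot.mk cubicPolyRat (C a * X ^ 2 + C b * X + C c) = (a : K) * θ ^ 2 + (b : K) * θ + c := by
  rw [map_add, map_add, map_mul, map_mul, map_pow, AdjoinRoot.mk_C, AdjoinRoot.mk_C,
    AdjoinRoot.mk_C, AdjoinRoot.mk_X, eq_ratCast, eq_ratCast, eq_ratCast]
  rfl

/-- **The norm form of `K` on `1, θ, θ²`.** [folklore] -/
theorem norm_quadratic (a b c : ℚ) :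
    Algebra.norm ℚ ((a : K) * θ ^ 2 + (b : K) * θ + c) =
      c * ((34 * a + c) * (35 * a - b + c) - (27 * a + 34 * b) * (b - a))
        - 61 * a * (b * (35 * a - b + c) - (27 * a + 34 * b) * a)
        + (-61 * a + 61 * b) * (b * (b - a) - (34 * a + c) * a) := by
  rw [← mk_quadratic, norm_mk_eq]

/-- **The trace form of `K` on `1, θ, θ²`**: `Tr(aθ² + bθ + c) = 69a - b + 3c`
(`Tr θ = -1`, `Tr θ² = 69`). [folklore] -/
theorem trace_quadratic (a b c : ℚ) :
    Algebra.trace ℚ K ((a : K) * θ ^ 2 + (b : K) * θ + c) = 69 * a - b + 3 * c := by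
  rw [← mk_quadratic, trace_mk_eq]

/-- `f'(θ) = 3θ² + 2θ - 34`. [folklore] -/
theorem aeval_derivative_minpoly :
    aeval θ (derivative (minpoly ℚ θ)) = ((3 : ℚ) : K) * θ ^ 2 + ((2 : ℚ) : K) * θ + ((-34 : ℚ) : K) := by
  rw [minpoly_rat_θ]
  simp only [map_add, map_sub, derivative_X_pow, derivative_mul, derivative_C, derivative_X,
    zero_mul, zero_add, mul_one, map_mul, map_pow, aeval_X, aeval_C, eq_ratCast,
    Rat.cast_ofNat, Rat.cast_neg, Nat.cast_ofNat, sub_zero]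
  ring

/-- `N(f'(θ)) = -95481`. [folklore] -/
theorem norm_aeval_derivative : Algebra.norm ℚ (aeval θ (derivative (minpoly ℚ θ))) = -95481 := by
  rw [aeval_derivative_minpoly, norm_quadratic]
  norm_num

/-- **`disc(1, θ, θ²) = 95481 = 9 · 103²`** (the discriminant of `X³ + X² - 34X - 61`).
[folklore] -/
theorem discr_pbθ : Algebra.discr ℚ pbθ.basis = 95481 := by
  rw [Algebra.discr_powerBasis_eq_norm, finrank_K, pbθ_gen, norm_aeval_derivative]
  norm_num

/-- A non-zero polynomial of degree `≤ 2` does not vanish at `θ`. [folklore] -/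
theorem quadratic_ne_zero {a b c : ℚ} (h : (a, b, c) ≠ (0, 0, 0)) :
    (a : K) * θ ^ 2 + (b : K) * θ + c ≠ 0 := by
  rw [← mk_quadratic, Ne, AdjoinRoot.mk_eq_zero]
  intro hdvd
  have hq0 : (C a * X ^ 2 + C b * X + C c : ℚ[X]) ≠ 0 := by
    intro h0
    apply h
    have ha : a = 0 := by simpa using congrArg (coeff · 2) h0
    have hb : b = 0 := by simpa [ha] using congrArg (coeff · 1) h0
    have hc : c = 0 := by simpa [ha, hb] using congrArg (coeff · 0) h0
    rw [ha, hb, hc]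
  have hdeg := degree_le_of_dvd hdvd hq0
  rw [cubicPolyRat_degree] at hdeg
  exact absurd (hdeg.trans degree_quadratic_le) (by decide)

/-! ### The algebraic integer `ω = (θ² - 1)/3` -/

/-- **`ω = (θ² - 1)/3`**, the third element of the integral basis `1, θ, ω` (with `θ` a Gaussian
period `η`, `ω = -σ(η) + 7` is again a period up to sign and an integer shift). [folklore] -/
def ω : K := (θ ^ 2 - 1) / 3

/-- `3ω = θ² - 1`. [folklore] -/
theorem three_mul_ω : 3 * ω = θ ^ 2 - 1 := by
  unfold ω
  rw [mul_div_cancel₀ _ (by norm_num : (3 : K) ≠ 0)]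

/-- `θ² = 3ω + 1`. [folklore] -/
theorem θ_sq : θ ^ 2 = 3 * ω + 1 := by rw [three_mul_ω]; ring

/-- `ω` is a root of `X³ - 22X² + 127X - 93`. [folklore] -/
theorem ω_rel : ω ^ 3 - 22 * ω ^ 2 + 127 * ω - 93 = 0 := by
  have h27 : (27 : K) ≠ 0 := by norm_num
  apply mul_left_cancel₀ h27
  rw [mul_zero]
  calc (27 : K) * (ω ^ 3 - 22 * ω ^ 2 + 127 * ω - 93)
      = (3 * ω) ^ 3 - 66 * (3 * ω) ^ 2 + 1143 * (3 * ω) - 2511 := by ring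
    _ = (θ ^ 2 - 1) ^ 3 - 66 * (θ ^ 2 - 1) ^ 2 + 1143 * (θ ^ 2 - 1) - 2511 := by rw [three_mul_ω]
    _ = 0 := by ring_nf; rw [θ_pow_six, θ_pow_four]; ring

/-- `ω` is an algebraic integer. [folklore] -/
theorem isIntegral_ω : IsIntegral ℤ ω := by
  refine ⟨X ^ 3 - C 22 * X ^ 2 + C 127 * X - C 93, by monicity!, ?_⟩
  show aeval ω (X ^ 3 - C 22 * X ^ 2 + C 127 * X - C 93 : ℤ[X]) = 0
  rw [map_sub, map_add, map_sub, map_pow, map_mul, map_mul, map_pow, aeval_C, aeval_C, aeval_C,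
    aeval_X, map_ofNat, map_ofNat, map_ofNat]
  exact ω_rel

/-- `θω = 20 + 11θ - ω`. [folklore] -/
theorem θ_mul_ω : θ * ω = 20 + 11 * θ - ω := by
  have h3 : (3 : K) ≠ 0 := by norm_num
  apply mul_left_cancel₀ h3
  calc (3 : K) * (θ * ω) = θ * (3 * ω) := by ring
    _ = θ * (θ ^ 2 - 1) := by rw [three_mul_ω]
    _ = 3 * (20 + 11 * θ) - (θ ^ 2 - 1) := by ring_nf; rw [θ_pow_three]; ring
    _ = 3 * (20 + 11 * θ - ω) := by rw [← three_mul_ω]; ring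

/-- `ω² = -3 + 3θ + 11ω`. [folklore] -/
theorem ω_sq : ω ^ 2 = -3 + 3 * θ + 11 * ω := by
  have h9 : (9 : K) ≠ 0 := by norm_num
  apply mul_left_cancel₀ h9
  calc (9 : K) * ω ^ 2 = (3 * ω) ^ 2 := by ring
    _ = (θ ^ 2 - 1) ^ 2 := by rw [three_mul_ω]
    _ = 9 * (-3 + 3 * θ) + 33 * (θ ^ 2 - 1) := by ring_nf; rw [θ_pow_four]; ring
    _ = 9 * (-3 + 3 * θ + 11 * ω) := by rw [← three_mul_ω]; ring

/-! ### `𝓞 K = ℤ ⊕ ℤθ ⊕ ℤω`: the `103`-part by Eisenstein, the `3`-part by traces -/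

/-- `θ` (as the generator of `pbθ`) is integral. [folklore] -/
theorem isIntegral_pbθ_gen : IsIntegral ℤ pbθ.gen := by rw [pbθ_gen]; exact isIntegral_θ

/-- `θ - 34` is integral over `ℚ`. [folklore] -/
theorem isIntegral_rat_θ_sub : IsIntegral ℚ (θ - 34 : K) := Algebra.IsIntegral.isIntegral _

/-- `ℚ(θ - 34) = K`. [folklore] -/
theorem adjoin_rat_θ_sub_eq_top : Algebra.adjoin ℚ ({θ - 34} : Set K) = ⊤ := by
  refine PowerBasis.adjoin_eq_top_of_gen_mem_adjoin (B := pbθ) ?_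
  have hmem : (θ - 34 : K) + algebraMap ℚ K 34 ∈ Algebra.adjoin ℚ ({θ - 34} : Set K) :=
    Subalgebra.add_mem _ (Algebra.self_mem_adjoin_singleton ℚ _) (Subalgebra.algebraMap_mem _ _)
  have h : (θ - 34 : K) + algebraMap ℚ K 34 = θ := by rw [map_ofNat]; ring
  rw [h] at hmem
  rw [pbθ_gen]
  exact hmem

/-- The power basis of `K/ℚ` generated by `θ - 34`. [folklore] -/
def pbθ' : PowerBasis ℚ K := PowerBasis.ofAdjoinEqTop isIntegral_rat_θ_sub adjoin_rat_θ_sub_eq_top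

/-- The generator of `pbθ'` is `θ - 34`. [folklore] -/
theorem pbθ'_gen : pbθ'.gen = θ - 34 := PowerBasis.ofAdjoinEqTop_gen _ _

/-- `θ - 34` is an algebraic integer. [folklore] -/
theorem isIntegral_θ_sub : IsIntegral ℤ (θ - 34 : K) := by
  have h : IsIntegral ℤ ((34 : ℤ) : K) := isIntegral_algebraMap
  rw [Int.cast_ofNat] at h
  exact isIntegral_θ.sub h


/-- `f(X + 34) = X³ + 103X² + 3502X + 39243` over `ℤ`. [folklore] -/
theorem cubicPoly_comp_X_add :
    cubicPoly.comp (X + C 34) = X ^ 3 + C 103 * X ^ 2 + C 3502 * X + C 39243 := by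
  have h34 : (C 34 : ℤ[X]) = 34 := map_ofNat C 34
  have h61 : (C 61 : ℤ[X]) = 61 := map_ofNat C 61
  have h103 : (C 103 : ℤ[X]) = 103 := map_ofNat C 103
  have h3502 : (C 3502 : ℤ[X]) = 3502 := map_ofNat C 3502
  have h39243 : (C 39243 : ℤ[X]) = 39243 := map_ofNat C 39243
  simp only [cubicPoly, add_comp, sub_comp, mul_comp, X_pow_comp, X_comp, C_comp]
  simp only [h34, h61, h103, h3502, h39243]
  ring

/-- `minpoly_ℚ(θ - 34) = f(X + 34)`. [folklore] -/
theorem minpoly_rat_θ_sub :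
    minpoly ℚ (θ - 34 : K) = (X ^ 3 + C 103 * X ^ 2 + C 3502 * X + C 39243 : ℤ[X]).map (algebraMap ℤ ℚ) := by
  have h₂ : minpoly ℚ (θ - 34 : K) = (minpoly ℚ θ).comp (X + C 34) := by
    have := minpoly.sub_algebraMap (θ : K) (34 : ℚ)
    rwa [show algebraMap ℚ K 34 = 34 from map_ofNat _ 34] at this
  rw [h₂, minpoly.isIntegrallyClosed_eq_field_fractions' ℚ isIntegral_θ, minpoly_int_θ,
    ← cubicPoly_comp_X_add, Polynomial.map_comp, Polynomial.map_add, map_X, Polynomial.map_C,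
    show algebraMap ℤ ℚ 34 = 34 from map_ofNat _ 34]

/-- `minpoly_ℤ(θ - 34) = f(X + 34) = X³ + 103X² + 3502X + 39243`. [folklore] -/
theorem minpoly_int_θ_sub :
    minpoly ℤ (θ - 34 : K) = X ^ 3 + C 103 * X ^ 2 + C 3502 * X + C 39243 := by
  apply map_injective (algebraMap ℤ ℚ) (algebraMap ℤ ℚ).injective_int
  rw [← minpoly.isIntegrallyClosed_eq_field_fractions' ℚ isIntegral_θ_sub, minpoly_rat_θ_sub]

/-- **`f(X + 34)` is Eisenstein at `103`**: `103 ∣ 103, 3502, 39243` and `103² ∤ 39243`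
(`103` is totally ramified in `K`). [folklore] -/
theorem isEisensteinAt_minpoly_θ_sub :
    (minpoly ℤ (θ - 34 : K)).IsEisensteinAt (Submodule.span ℤ {(103 : ℤ)}) := by
  rw [minpoly_int_θ_sub]
  have hmonic : (X ^ 3 + C 103 * X ^ 2 + C 3502 * X + C 39243 : ℤ[X]).Monic := by monicity!
  have hdeg : (X ^ 3 + C 103 * X ^ 2 + C 3502 * X + C 39243 : ℤ[X]).natDegree = 3 := by
    compute_degree!
  refine ⟨?_, fun {n} hn => ?_, ?_⟩
  · rw [hmonic.leadingCoeff, Ideal.mem_span_singleton]; norm_num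
  · rw [hdeg] at hn
    rw [Ideal.mem_span_singleton]
    interval_cases n <;> simp [coeff_X_pow, coeff_X]
  · rw [Ideal.span_singleton_pow, Ideal.mem_span_singleton]
    simp [coeff_X_pow, coeff_X]

/-- `ℤ[θ - 34] = ℤ[θ]`. [folklore] -/
theorem adjoin_θ_sub_eq : Algebra.adjoin ℤ ({θ - 34} : Set K) = Algebra.adjoin ℤ ({θ} : Set K) := by
  apply le_antisymm
  · refine Algebra.adjoin_le (Set.singleton_subset_iff.mpr ?_)
    exact Subalgebra.sub_mem _ (Algebra.self_mem_adjoin_singleton ℤ _) (Subalgebra.natCast_mem _ 34)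
  · refine Algebra.adjoin_le (Set.singleton_subset_iff.mpr ?_)
    have hmem : (θ - 34 : K) + 34 ∈ Algebra.adjoin ℤ ({θ - 34} : Set K) :=
      Subalgebra.add_mem _ (Algebra.self_mem_adjoin_singleton ℤ _) (Subalgebra.natCast_mem _ 34)
    have h : (θ - 34 : K) + 34 = θ := by ring
    rw [h] at hmem
    exact hmem

/-- **The `103`-part of the index: `9z ∈ ℤ[θ]` for every algebraic integer `z` of `K`.**
`disc(1, θ, θ²) z = 9 · 103² z ∈ ℤ[θ]` (`Algebra.discr_mul_isIntegral_mem_adjoin`), and the factor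
`103²` is removed by Eisenstein's criterion for `minpoly(θ - 34)` at `103`
(`mem_adjoin_of_smul_prime_pow_smul_of_minpoly_isEisensteinAt`). [folklore] -/
theorem nine_smul_mem_adjoin {z : K} (hz : IsIntegral ℤ z) :
    (9 : ℤ) • z ∈ Algebra.adjoin ℤ ({θ} : Set K) := by
  have H := Algebra.discr_mul_isIntegral_mem_adjoin ℚ isIntegral_pbθ_gen hz
  rw [discr_pbθ, pbθ_gen] at H
  have h9int : IsIntegral ℤ ((9 : ℤ) • z) := by
    rw [zsmul_eq_mul]
    exact (isIntegral_algebraMap (x := (9 : ℤ))).mul hz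
  have hmem : (103 : ℤ) ^ 2 • ((9 : ℤ) • z) ∈ Algebra.adjoin ℤ ({pbθ'.gen} : Set K) := by
    rw [pbθ'_gen, adjoin_θ_sub_eq, smul_smul]
    have h : ((103 : ℤ) ^ 2 * 9) • z = (95481 : ℚ) • z := by
      rw [zsmul_eq_mul, Algebra.smul_def, map_ofNat]
      push_cast
      norm_num
    rw [h]
    exact H
  have hp : Prime (103 : ℤ) := Int.prime_iff_natAbs_prime.mpr (by norm_num)
  have key := mem_adjoin_of_smul_prime_pow_smul_of_minpoly_isEisensteinAt (K := ℚ) (B := pbθ')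
    hp (by rw [pbθ'_gen]; exact isIntegral_θ_sub) h9int hmem
    (by rw [pbθ'_gen]; exact isEisensteinAt_minpoly_θ_sub)
  rwa [pbθ'_gen, adjoin_θ_sub_eq] at key

/-- Elements of `ℤ[θ]` have integer coordinates on `1, θ, θ²` (reduce a polynomial in `θ`
modulo the monic `f`). [folklore] -/
theorem exists_coords_of_mem_adjoin {z : K} (hz : z ∈ Algebra.adjoin ℤ ({θ} : Set K)) :
    ∃ a b c : ℤ, z = (a : K) * θ ^ 2 + (b : K) * θ + c := by
  rw [Algebra.adjoin_singleton_eq_range_aeval] at hz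
  obtain ⟨q, rfl⟩ := hz
  set r := q %ₘ cubicPoly with hr
  have hmod : aeval θ r = aeval θ q := by
    rw [hr, Polynomial.modByMonic_eq_sub_mul_div q cubicPoly, map_sub, map_mul,
      aeval_θ_cubicPoly, zero_mul, sub_zero]
  have hne : cubicPoly ≠ 1 :=
    ne_of_apply_ne natDegree (by rw [cubicPoly_natDegree, natDegree_one]; norm_num)
  have hdeg : r.natDegree < 3 := by
    rw [hr, ← cubicPoly_natDegree]
    exact natDegree_modByMonic_lt q cubicPoly_monic hne
  have hsum : r = C (r.coeff 0) + C (r.coeff 1) * X + C (r.coeff 2) * X ^ 2 := by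
    conv_lhs => rw [r.as_sum_range_C_mul_X_pow' hdeg]
    simp [Finset.sum_range_succ]
  refine ⟨r.coeff 2, r.coeff 1, r.coeff 0, ?_⟩
  change aeval θ q = _
  rw [← hmod]
  conv_lhs => rw [hsum]
  simp only [map_add, map_mul, map_pow, aeval_X, eq_intCast, map_intCast]
  ring

/-- The trace of an algebraic integer is a rational integer. [folklore] -/
theorem exists_int_eq_trace {z : K} (hz : IsIntegral ℤ z) : ∃ m : ℤ, (m : ℚ) = Algebra.trace ℚ K z :=
  IsIntegrallyClosed.isIntegral_iff.mp (Algebra.isIntegral_trace hz)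

/-- Traces of `z`, `zθ`, `zω` for `9z = a₀θ² + b₀θ + c₀`. [folklore] -/
theorem traces_of_nine_mul_eq {z : K} {a₀ b₀ c₀ : ℤ}
    (h9 : 9 * z = (a₀ : K) * θ ^ 2 + (b₀ : K) * θ + c₀) :
    Algebra.trace ℚ K z = (69 * a₀ - b₀ + 3 * c₀) / 9 ∧
    Algebra.trace ℚ K (z * θ) = (80 * a₀ + 69 * b₀ - c₀) / 9 ∧
    Algebra.trace ℚ K (z * ω) = (2136 * a₀ + 81 * b₀ + 66 * c₀) / 27 := by
  have h9K : (9 : K) ≠ 0 := by norm_num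
  have h27K : (27 : K) ≠ 0 := by norm_num
  have hz : z = ((a₀ / 9 : ℚ) : K) * θ ^ 2 + ((b₀ / 9 : ℚ) : K) * θ + ((c₀ / 9 : ℚ) : K) := by
    apply mul_left_cancel₀ h9K
    rw [h9]
    push_cast
    ring
  have hzθ : z * θ = (((b₀ - a₀) / 9 : ℚ) : K) * θ ^ 2 + (((34 * a₀ + c₀) / 9 : ℚ) : K) * θ +
      (((61 * a₀) / 9 : ℚ) : K) := by
    apply mul_left_cancel₀ h9K
    calc (9 : K) * (z * θ) = (9 * z) * θ := by ring
      _ = ((a₀ : K) * θ ^ 2 + (b₀ : K) * θ + c₀) * θ := by rw [h9]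
      _ = (a₀ : K) * θ ^ 3 + (b₀ : K) * θ ^ 2 + (c₀ : K) * θ := by ring
      _ = _ := by rw [θ_pow_three]; push_cast; ring
  have hzω : z * ω = (((34 * a₀ - b₀ + c₀) / 27 : ℚ) : K) * θ ^ 2 +
      (((27 * a₀ + 33 * b₀) / 27 : ℚ) : K) * θ + (((-61 * a₀ + 61 * b₀ - c₀) / 27 : ℚ) : K) := by
    apply mul_left_cancel₀ h27K
    calc (27 : K) * (z * ω) = (9 * z) * (3 * ω) := by ring
      _ = ((a₀ : K) * θ ^ 2 + (b₀ : K) * θ + c₀) * (θ ^ 2 - 1) := by rw [h9, three_mul_ω]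
      _ = (a₀ : K) * θ ^ 4 + (b₀ : K) * θ ^ 3 + ((c₀ : K) - a₀) * θ ^ 2 - (b₀ : K) * θ - c₀ := by
          ring
      _ = _ := by rw [θ_pow_four, θ_pow_three]; push_cast; ring
  refine ⟨?_, ?_, ?_⟩
  · rw [hz, trace_quadratic]; ring
  · rw [hzθ, trace_quadratic]; ring
  · rw [hzω, trace_quadratic]; ring

/-- The linear congruences: integrality of the three traces forces `3 ∣ a₀`, `9 ∣ b₀`,
`9 ∣ a₀ + c₀`. [folklore] -/
theorem dvd_of_traces {a₀ b₀ c₀ t₀ t₁ t₂ : ℤ} (i₀ : t₀ * 9 = 69 * a₀ - b₀ + 3 * c₀)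
    (i₁ : t₁ * 9 = 80 * a₀ + 69 * b₀ - c₀) (i₂ : t₂ * 27 = 2136 * a₀ + 81 * b₀ + 66 * c₀) :
    ∃ a b c : ℤ, c₀ = 9 * a - 3 * c ∧ b₀ = 9 * b ∧ a₀ = 3 * c := by
  -- reduce the coefficients (`69 = 63 + 6`, `80 = 81 - 1`, `2136 = 79·27 + 3`, `66 = 54 + 12`)
  obtain ⟨s₂, hs₂⟩ : ∃ s, a₀ + 4 * c₀ = 9 * s := ⟨t₂ - 79 * a₀ - 3 * b₀ - 2 * c₀, by linarith⟩
  obtain ⟨s₁, hs₁⟩ : ∃ s, -a₀ + 6 * b₀ - c₀ = 9 * s := ⟨t₁ - 9 * a₀ - 7 * b₀, by linarith⟩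
  obtain ⟨s₀, hs₀⟩ : ∃ s, 6 * a₀ - b₀ + 3 * c₀ = 9 * s := ⟨t₀ - 7 * a₀, by linarith⟩
  clear i₀ i₁ i₂
  obtain ⟨b₁, hb₁⟩ : ∃ b₁, b₀ = 3 * b₁ := ⟨2 * a₀ + c₀ - 3 * s₀, by linarith⟩
  obtain ⟨u, hu⟩ : ∃ u, a₀ + c₀ = 9 * u := ⟨2 * b₁ - s₁, by subst hb₁; linarith⟩
  obtain ⟨c₁, hc₁⟩ : ∃ c₁, c₀ = 3 * c₁ := ⟨s₂ - u, by linarith⟩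
  obtain ⟨c, hc⟩ : ∃ c, a₀ = 3 * c := ⟨3 * u - c₁, by linarith⟩
  exact ⟨u, c + 3 * u - s₀, c, by linarith, by linarith, hc⟩

/-- **`𝓞 K = ℤ ⊕ ℤθ ⊕ ℤω`: every algebraic integer of `K` has integer coordinates on `1, θ, ω`.**
From `9z = a₀θ² + b₀θ + c₀ ∈ ℤ[θ]` (`nine_smul_mem_adjoin`) and the integrality of the traces
`Tr z = (69a₀ - b₀ + 3c₀)/9`, `Tr(zθ) = (80a₀ + 69b₀ - c₀)/9`, `Tr(zω) = (2136a₀ + 81b₀ + 66c₀)/27`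
one gets `3 ∣ a₀`, `9 ∣ b₀`, `9 ∣ a₀ + c₀`, i.e. `z = (a₀ + c₀)/9 + (b₀/9) θ + (a₀/3) ω`
with integer coefficients. [folklore] -/
theorem exists_int_coords_of_isIntegral {z : K} (hz : IsIntegral ℤ z) :
    ∃ a b c : ℤ, z = (a : K) + (b : K) * θ + (c : K) * ω := by
  obtain ⟨a₀, b₀, c₀, h9⟩ := exists_coords_of_mem_adjoin (nine_smul_mem_adjoin hz)
  rw [zsmul_eq_mul] at h9
  push_cast at h9
  obtain ⟨tr₀, tr₁, tr₂⟩ := traces_of_nine_mul_eq h9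
  obtain ⟨t₀, ht₀⟩ := exists_int_eq_trace hz
  obtain ⟨t₁, ht₁⟩ := exists_int_eq_trace (hz.mul isIntegral_θ)
  obtain ⟨t₂, ht₂⟩ := exists_int_eq_trace (hz.mul isIntegral_ω)
  rw [tr₀] at ht₀
  rw [tr₁] at ht₁
  rw [tr₂] at ht₂
  have i₀ : t₀ * 9 = 69 * a₀ - b₀ + 3 * c₀ := by
    field_simp at ht₀; exact_mod_cast ht₀
  have i₁ : t₁ * 9 = 80 * a₀ + 69 * b₀ - c₀ := by
    field_simp at ht₁; exact_mod_cast ht₁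
  have i₂ : t₂ * 27 = 2136 * a₀ + 81 * b₀ + 66 * c₀ := by
    field_simp at ht₂; exact_mod_cast ht₂
  obtain ⟨a, b, c, ha, hb, hc⟩ := dvd_of_traces i₀ i₁ i₂
  refine ⟨a, b, c, ?_⟩
  have ha' : ((c₀ : ℤ) : K) = 9 * (a : K) - 3 * (c : K) := by rw [ha]; push_cast; ring
  have hb' : ((b₀ : ℤ) : K) = 9 * (b : K) := by rw [hb]; push_cast; ring
  have hc' : ((a₀ : ℤ) : K) = 3 * (c : K) := by rw [hc]; push_cast; ring
  apply mul_left_cancel₀ (by norm_num : (9 : K) ≠ 0)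
  rw [h9, ha', hb', hc']
  calc 3 * (c : K) * θ ^ 2 + 9 * (b : K) * θ + (9 * (a : K) - 3 * (c : K))
      = 9 * a + 9 * b * θ + 3 * c * (θ ^ 2 - 1) := by ring
    _ = 9 * ((a : K) + (b : K) * θ + (c : K) * ω) := by rw [← three_mul_ω]; ring

/-- `θ` as an element of `𝓞 K`. [folklore] -/
def θint : 𝓞 K := ⟨θ, isIntegral_θ⟩

/-- `ω` as an element of `𝓞 K`. [folklore] -/
def ωint : 𝓞 K := ⟨ω, isIntegral_ω⟩

/-- The coercion of `θint` to `K` is `θ`. [folklore] -/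
@[simp] theorem coe_θint : ((θint : 𝓞 K) : K) = θ := rfl

/-- The coercion of `ωint` to `K` is `ω`. [folklore] -/
@[simp] theorem coe_ωint : ((ωint : 𝓞 K) : K) = ω := rfl

/-- **Integer coordinates on the integral basis `1, θ, ω`** for elements of `𝓞 K`. [folklore] -/
theorem exists_int_coords (z : 𝓞 K) : ∃ a b c : ℤ, z = a + b * θint + c * ωint := by
  obtain ⟨a, b, c, h⟩ := exists_int_coords_of_isIntegral z.2
  refine ⟨a, b, c, RingOfIntegers.coe_injective ?_⟩
  simp only [map_add, map_mul, map_intCast, coe_θint, coe_ωint]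
  exact h

/-- The relations of the integral basis in `𝓞 K`: `θ² = 1 + 3ω`, `θω = 20 + 11θ - ω`,
`ω² = -3 + 3θ + 11ω`. [folklore] -/
theorem int_basis_rel : (θint : 𝓞 K) ^ 2 = 1 + 3 * ωint ∧ θint * ωint = 20 + 11 * θint - ωint ∧
    (ωint : 𝓞 K) ^ 2 = -3 + 3 * θint + 11 * ωint := by
  refine ⟨?_, ?_, ?_⟩ <;> apply RingOfIntegers.coe_injective <;>
    simp only [map_add, map_sub, map_mul, map_pow, map_one, map_neg, coe_θint, coe_ωint, map_ofNat]
  · rw [θ_sq]; ring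
  · exact θ_mul_ω
  · exact ω_sq

/-- The cubic relation in `𝓞 K`: `θ³ + θ² - 34θ - 61 = 0`. [folklore] -/
theorem θint_rel : (θint : 𝓞 K) ^ 3 + θint ^ 2 - 34 * θint - 61 = 0 := by
  apply RingOfIntegers.coe_injective
  simp only [map_add, map_sub, map_mul, map_pow, map_zero, coe_θint, map_ofNat]
  rw [θ_pow_three]
  ring


/-! ### The units `u₁ = -2 + 3θ + 2ω` and `u₂ = 49 + 2θ - 5ω` -/

/-- A product identity in `𝓞 K` is checked in `K` after clearing the denominator `3` of `ω`.
[folklore] -/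
theorem mul_eq_one_of_K {x y : 𝓞 K} (h : (x : K) * y = 1) : x * y = 1 :=
  RingOfIntegers.coe_injective (by rw [map_mul, map_one]; exact h)

/-- `(-2 + 3θ + 2ω)(67 + 27θ - 19ω) = 1` in `K`. [folklore] -/
theorem u₁_mul_inv_K : (-2 + 3 * θ + 2 * ω) * (67 + 27 * θ - 19 * ω) = (1 : K) := by
  have h9 : (9 : K) ≠ 0 := by norm_num
  apply mul_left_cancel₀ h9
  calc (9 : K) * ((-2 + 3 * θ + 2 * ω) * (67 + 27 * θ - 19 * ω))
      = (-6 + 9 * θ + 2 * (3 * ω)) * (201 + 81 * θ - 19 * (3 * ω)) := by ring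
    _ = (-6 + 9 * θ + 2 * (θ ^ 2 - 1)) * (201 + 81 * θ - 19 * (θ ^ 2 - 1)) := by rw [three_mul_ω]
    _ = 9 * 1 := by ring_nf; rw [θ_pow_four, θ_pow_three]; ring

/-- `(49 + 2θ - 5ω)(-29 - 19θ - 8ω) = 1` in `K`. [folklore] -/
theorem u₂_mul_inv_K : (49 + 2 * θ - 5 * ω) * (-29 - 19 * θ - 8 * ω) = (1 : K) := by
  have h9 : (9 : K) ≠ 0 := by norm_num
  apply mul_left_cancel₀ h9
  calc (9 : K) * ((49 + 2 * θ - 5 * ω) * (-29 - 19 * θ - 8 * ω))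
      = (147 + 6 * θ - 5 * (3 * ω)) * (-87 - 57 * θ - 8 * (3 * ω)) := by ring
    _ = (147 + 6 * θ - 5 * (θ ^ 2 - 1)) * (-87 - 57 * θ - 8 * (θ ^ 2 - 1)) := by rw [three_mul_ω]
    _ = 9 * 1 := by ring_nf; rw [θ_pow_four, θ_pow_three]; ring

/-- **The unit `u₁ = -2 + 3θ + 2ω`** of `𝓞 K` (norm `1`), with inverse `67 + 27θ - 19ω`.
[folklore] -/
def unit₁ : (𝓞 K)ˣ :=
  Units.mkOfMulEqOne (-2 + 3 * θint + 2 * ωint) (67 + 27 * θint - 19 * ωint)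
    (mul_eq_one_of_K (by
      simp only [map_add, map_sub, map_mul, map_neg, map_ofNat, coe_θint, coe_ωint]
      exact u₁_mul_inv_K))

/-- **The unit `u₂ = 49 + 2θ - 5ω = σ(u₁)`** of `𝓞 K` (norm `1`), with inverse `-29 - 19θ - 8ω`.
[folklore] -/
def unit₂ : (𝓞 K)ˣ :=
  Units.mkOfMulEqOne (49 + 2 * θint - 5 * ωint) (-29 - 19 * θint - 8 * ωint)
    (mul_eq_one_of_K (by
      simp only [map_add, map_sub, map_mul, map_neg, map_ofNat, coe_θint, coe_ωint]
      exact u₂_mul_inv_K))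

/-- The underlying element of `unit₁`. [folklore] -/
@[simp] theorem coe_unit₁ : ((unit₁ : (𝓞 K)ˣ) : 𝓞 K) = -2 + 3 * θint + 2 * ωint := rfl

/-- The underlying element of `unit₂`. [folklore] -/
@[simp] theorem coe_unit₂ : ((unit₂ : (𝓞 K)ˣ) : 𝓞 K) = 49 + 2 * θint - 5 * ωint := rfl

/-- The underlying element of `unit₁⁻¹`. [folklore] -/
@[simp] theorem coe_unit₁_inv : ((unit₁⁻¹ : (𝓞 K)ˣ) : 𝓞 K) = 67 + 27 * θint - 19 * ωint := rfl

/-- The underlying element of `unit₂⁻¹`. [folklore] -/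
@[simp] theorem coe_unit₂_inv : ((unit₂⁻¹ : (𝓞 K)ˣ) : 𝓞 K) = -29 - 19 * θint - 8 * ωint := rfl

/-- `u₁ = (2/3)θ² + 3θ - 8/3` on the power basis. [folklore] -/
theorem u₁_eq_quadratic : (-2 + 3 * θ + 2 * ω : K) =
    ((2 / 3 : ℚ) : K) * θ ^ 2 + ((3 : ℚ) : K) * θ + ((-8 / 3 : ℚ) : K) := by
  rw [show ω = (θ ^ 2 - 1) / 3 from rfl]; push_cast; ring

/-- `u₂ = -(5/3)θ² + 2θ + 152/3` on the power basis. [folklore] -/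
theorem u₂_eq_quadratic : (49 + 2 * θ - 5 * ω : K) =
    ((-5 / 3 : ℚ) : K) * θ ^ 2 + ((2 : ℚ) : K) * θ + ((152 / 3 : ℚ) : K) := by
  rw [show ω = (θ ^ 2 - 1) / 3 from rfl]; push_cast; ring

/-- `N(u₁) = 1`. [folklore] -/
theorem norm_u₁ : Algebra.norm ℚ (-2 + 3 * θ + 2 * ω : K) = 1 := by
  rw [u₁_eq_quadratic, norm_quadratic]; norm_num

/-- `N(u₂) = 1`. [folklore] -/
theorem norm_u₂ : Algebra.norm ℚ (49 + 2 * θ - 5 * ω : K) = 1 := by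
  rw [u₂_eq_quadratic, norm_quadratic]; norm_num

/-! ### The automorphism `σ : θ ↦ (22 - θ²)/3 = 7 - ω` of order `3`; `K/ℚ` is Galois -/

/-- `s(θ) = (22 - θ²)/3` is again a root of `f`. [folklore] -/
theorem aeval_σθ : aeval ((22 - θ ^ 2) / 3 : K) cubicPolyRat = 0 := by
  have h27 : (27 : K) ≠ 0 := by norm_num
  refine (aeval_map_algebraMap ℚ _ cubicPoly).trans ?_
  rw [cubicPoly, map_sub, map_sub, map_add, map_pow, map_pow, map_mul, aeval_C, aeval_X, aeval_C,
    map_ofNat, map_ofNat]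
  apply mul_left_cancel₀ h27
  rw [mul_zero]
  calc (27 : K) * (((22 - θ ^ 2) / 3) ^ 3 + ((22 - θ ^ 2) / 3) ^ 2 - 34 * ((22 - θ ^ 2) / 3) - 61)
      = (22 - θ ^ 2) ^ 3 + 3 * (22 - θ ^ 2) ^ 2 - 306 * (22 - θ ^ 2) - 1647 := by field_simp; ring
    _ = 0 := by ring_nf; rw [θ_pow_six, θ_pow_four]; ring

/-- The `ℚ`-algebra endomorphism of `K` sending `θ ↦ (22 - θ²)/3`. [folklore] -/
def σHom : K →ₐ[ℚ] K :=
  AdjoinRoot.liftAlgHom cubicPolyRat (Algebra.ofId ℚ K) ((22 - θ ^ 2) / 3) aeval_σθ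

/-- `σHom θ = (22 - θ²)/3`. [folklore] -/
theorem σHom_θ : σHom θ = (22 - θ ^ 2) / 3 := AdjoinRoot.liftAlgHom_root _ _ _ _

/-- **The automorphism `σ` of `K/ℚ`**, `σ(θ) = (22 - θ²)/3`. [folklore] -/
def σ : K ≃ₐ[ℚ] K :=
  AlgEquiv.ofBijective σHom ⟨(σHom : K →+* K).injective,
    LinearMap.surjective_of_injective (f := σHom.toLinearMap) (σHom : K →+* K).injective⟩

/-- `σ θ = (22 - θ²)/3`. [folklore] -/
theorem σ_θ : σ θ = (22 - θ ^ 2) / 3 := σHom_θ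

/-- `σ θ = 7 - ω`. [folklore] -/
theorem σ_θ' : σ θ = 7 - ω := by
  rw [σ_θ, show ω = (θ ^ 2 - 1) / 3 from rfl]; ring

/-- `σ ω = 15 + θ - ω`. [folklore] -/
theorem σ_ω : σ ω = 15 + θ - ω := by
  have h27 : (27 : K) ≠ 0 := by norm_num
  rw [show ω = (θ ^ 2 - 1) / 3 from rfl, map_div₀, map_sub, map_pow, map_one, σ_θ, map_ofNat]
  apply mul_left_cancel₀ h27
  calc (27 : K) * ((((22 - θ ^ 2) / 3) ^ 2 - 1) / 3) = (22 - θ ^ 2) ^ 2 - 9 := by field_simp; ring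
    _ = 27 * (15 + θ - (θ ^ 2 - 1) / 3) := by
        field_simp; ring_nf; rw [θ_pow_four]; ring

/-- `σ² θ = (θ² - 3θ - 25)/3 = ω - θ - 8` (the third root). [folklore] -/
theorem σ_σ_θ : σ (σ θ) = ω - θ - 8 := by
  rw [σ_θ', map_sub, map_ofNat, σ_ω]; ring

/-- `σ³ = 1`: `σ(ω - θ - 8) = θ`. [folklore] -/
theorem σ_σ_σ_θ : σ (σ (σ θ)) = θ := by
  rw [σ_σ_θ, map_sub, map_sub, map_ofNat, σ_ω, σ_θ']; ring

/-- A `ℚ`-algebra endomorphism of `K = ℚ(θ)` is determined by the image of `θ`. [folklore] -/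
theorem algEquiv_eq_of_apply_θ {g h : K ≃ₐ[ℚ] K} (hgh : g θ = h θ) : g = h := by
  apply AlgEquiv.coe_toAlgHom_injective
  refine AdjoinRoot.algHom_ext ?_
  change g θ = h θ
  exact hgh

/-- `σ³ = 1` in `Gal(K/ℚ)`. [folklore] -/
theorem σ_pow_three : σ ^ 3 = 1 :=
  algEquiv_eq_of_apply_θ (by rw [pow_three, AlgEquiv.mul_apply, AlgEquiv.mul_apply, σ_σ_σ_θ]; rfl)

/-- `σ ≠ 1` (`σ θ = θ` would mean `θ² + 3θ - 22 = 0`). [folklore] -/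
theorem σ_ne_one : σ ≠ 1 := by
  intro h
  have e : σ θ = θ := by rw [h]; rfl
  rw [σ_θ] at e
  have : ((-1 : ℚ) : K) * θ ^ 2 + ((-3 : ℚ) : K) * θ + ((22 : ℚ) : K) = 0 := by
    push_cast; field_simp at e; linear_combination e
  exact quadratic_ne_zero (by norm_num) this

/-- `σ² ≠ 1` (`σ² θ = θ` would mean `θ² - 6θ - 25 = 0`). [folklore] -/
theorem σ_sq_ne_one : σ ^ 2 ≠ 1 := by
  intro h
  have e : σ (σ θ) = θ := by rw [← AlgEquiv.mul_apply, ← pow_two, h]; rfl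
  rw [σ_σ_θ, show ω = (θ ^ 2 - 1) / 3 from rfl] at e
  have : ((1 : ℚ) : K) * θ ^ 2 + ((-6 : ℚ) : K) * θ + ((-25 : ℚ) : K) = 0 := by
    push_cast; field_simp at e; linear_combination e
  exact quadratic_ne_zero (by norm_num) this

/-- `σ² ≠ σ`. [folklore] -/
theorem σ_sq_ne_σ : σ ^ 2 ≠ σ := fun h => σ_ne_one (by
  have := congrArg (· * σ⁻¹) h
  simpa [pow_two, mul_assoc] using this)

/-- **`|Gal(K/ℚ)| = 3`**: `1, σ, σ²` are distinct and `|Aut_ℚ(K)| ≤ [K : ℚ] = 3`. [folklore] -/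
theorem card_gal : Nat.card (K ≃ₐ[ℚ] K) = 3 := by
  classical
  rw [Nat.card_eq_fintype_card]
  refine le_antisymm (finrank_K ▸ AlgEquiv.card_le) ?_
  have h3 : ({1, σ, σ ^ 2} : Finset (K ≃ₐ[ℚ] K)).card = 3 := by
    rw [Finset.card_insert_of_notMem, Finset.card_insert_of_notMem, Finset.card_singleton]
    · rw [Finset.mem_singleton]; exact σ_sq_ne_σ.symm
    · rw [Finset.mem_insert, Finset.mem_singleton, not_or]
      exact ⟨σ_ne_one.symm, σ_sq_ne_one.symm⟩
  rw [← h3]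
  exact Finset.card_le_univ _

/-- **`K/ℚ` is Galois** (cyclic of degree `3`). [folklore] -/
instance isGalois : IsGalois ℚ K := IsGalois.of_card_aut_eq_finrank ℚ K (card_gal.trans finrank_K.symm)

/-- Every element of `Gal(K/ℚ)` is `1`, `σ` or `σ²`. [folklore] -/
theorem gal_cases (g : K ≃ₐ[ℚ] K) : g = 1 ∨ g = σ ∨ g = σ ^ 2 := by
  classical
  by_contra h
  simp only [not_or] at h
  have h4 : ({1, σ, σ ^ 2, g} : Finset (K ≃ₐ[ℚ] K)).card = 4 := by
    rw [Finset.card_insert_of_notMem, Finset.card_insert_of_notMem, Finset.card_insert_of_notMem,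
      Finset.card_singleton]
    · rw [Finset.mem_singleton]; exact fun e => h.2.2 e.symm
    · rw [Finset.mem_insert, Finset.mem_singleton, not_or]
      exact ⟨σ_sq_ne_σ.symm, fun e => h.2.1 e.symm⟩
    · rw [Finset.mem_insert, Finset.mem_insert, Finset.mem_singleton, not_or, not_or]
      exact ⟨σ_ne_one.symm, σ_sq_ne_one.symm, fun e => h.1 e.symm⟩
  have hle : ({1, σ, σ ^ 2, g} : Finset (K ≃ₐ[ℚ] K)).card ≤ Fintype.card (K ≃ₐ[ℚ] K) :=
    Finset.card_le_univ _
  rw [h4, ← Nat.card_eq_fintype_card, card_gal] at hle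
  omega

/-- **`N_{K/ℚ}(x) = x · σx · σ²x`** for every `x ∈ K`. [folklore] -/
theorem norm_eq_mul_σ_mul_σσ (x : K) : algebraMap ℚ K (Algebra.norm ℚ x) = x * σ x * σ (σ x) := by
  classical
  rw [Algebra.norm_eq_prod_automorphisms]
  have huniv : (Finset.univ : Finset (K ≃ₐ[ℚ] K)) = {1, σ, σ ^ 2} := by
    ext g
    simp only [Finset.mem_univ, Finset.mem_insert, Finset.mem_singleton, true_iff]
    exact gal_cases g
  rw [huniv, Finset.prod_insert, Finset.prod_insert, Finset.prod_singleton]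
  · rw [pow_two, AlgEquiv.mul_apply, AlgEquiv.one_apply, mul_assoc]
  · rw [Finset.mem_singleton]; exact σ_sq_ne_σ.symm
  · rw [Finset.mem_insert, Finset.mem_singleton, not_or]; exact ⟨σ_ne_one.symm, σ_sq_ne_one.symm⟩

/-! ### The three real embeddings and the signs of `u₁`, `u₂` -/

/-- The real cubic function `p(x) = x³ + x² - 34x - 61`. [folklore] -/
def preal (x : ℝ) : ℝ := x ^ 3 + x ^ 2 - 34 * x - 61

/-- `p` is continuous. [folklore] -/
theorem continuous_preal : Continuous preal := by unfold preal; fun_prop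

/-- `f` has a real root in each of `(-6, -5)`, `(-2, -1)`, `(6, 7)` (sign changes
`p(-6) = -37 < 0 < 9 = p(-5)`, `p(-2) = 3 > 0 > -27 = p(-1)`, `p(6) = -13 < 0 < 93 = p(7)`).
[folklore] -/
theorem exists_roots_preal :
    (∃ r, r ∈ Set.Ioo (-6 : ℝ) (-5) ∧ preal r = 0) ∧ (∃ r, r ∈ Set.Ioo (-2 : ℝ) (-1) ∧ preal r = 0) ∧
      (∃ r, r ∈ Set.Ioo (6 : ℝ) 7 ∧ preal r = 0) := by
  refine ⟨?_, ?_, ?_⟩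
  · have h := intermediate_value_Ioo (show (-6 : ℝ) ≤ -5 by norm_num) continuous_preal.continuousOn
    have h0 : (0 : ℝ) ∈ Set.Ioo (preal (-6)) (preal (-5)) := by simp only [preal, Set.mem_Ioo]; norm_num
    obtain ⟨r, hr, hr0⟩ := h h0
    exact ⟨r, hr, hr0⟩
  · have h := intermediate_value_Ioo' (show (-2 : ℝ) ≤ -1 by norm_num) continuous_preal.continuousOn
    have h0 : (0 : ℝ) ∈ Set.Ioo (preal (-1)) (preal (-2)) := by simp only [preal, Set.mem_Ioo]; norm_num
    obtain ⟨r, hr, hr0⟩ := h h0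
    exact ⟨r, hr, hr0⟩
  · have h := intermediate_value_Ioo (show (6 : ℝ) ≤ 7 by norm_num) continuous_preal.continuousOn
    have h0 : (0 : ℝ) ∈ Set.Ioo (preal 6) (preal 7) := by simp only [preal, Set.mem_Ioo]; norm_num
    obtain ⟨r, hr, hr0⟩ := h h0
    exact ⟨r, hr, hr0⟩

/-- The real root `r₁ ∈ (-6, -5)` of `f` (`≈ -5.259`). [folklore] -/
def r₁ : ℝ := Classical.choose exists_roots_preal.1
/-- The real root `r₂ ∈ (-2, -1)` of `f` (`≈ -1.887`). [folklore] -/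
def r₂ : ℝ := Classical.choose exists_roots_preal.2.1
/-- The real root `r₃ ∈ (6, 7)` of `f` (`≈ 6.146`). [folklore] -/
def r₃ : ℝ := Classical.choose exists_roots_preal.2.2

/-- `-6 < r₁ < -5` and `p(r₁) = 0`. [folklore] -/
theorem r₁_spec : r₁ ∈ Set.Ioo (-6 : ℝ) (-5) ∧ preal r₁ = 0 := Classical.choose_spec exists_roots_preal.1
/-- `-2 < r₂ < -1` and `p(r₂) = 0`. [folklore] -/
theorem r₂_spec : r₂ ∈ Set.Ioo (-2 : ℝ) (-1) ∧ preal r₂ = 0 := Classical.choose_spec exists_roots_preal.2.1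
/-- `6 < r₃ < 7` and `p(r₃) = 0`. [folklore] -/
theorem r₃_spec : r₃ ∈ Set.Ioo (6 : ℝ) 7 ∧ preal r₃ = 0 := Classical.choose_spec exists_roots_preal.2.2

/-- A real root of `p` is a root of `cubicPolyRat` under `ℚ → ℝ`. [folklore] -/
theorem eval₂_cubicPolyRat_real {r : ℝ} (hr : preal r = 0) :
    cubicPolyRat.eval₂ (algebraMap ℚ ℝ) r = 0 := by
  rw [eval₂_map, cubicPoly, eval₂_sub, eval₂_sub, eval₂_add, eval₂_X_pow, eval₂_X_pow, eval₂_mul,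
    eval₂_C, eval₂_X, eval₂_C, map_ofNat, map_ofNat]
  exact hr

/-- **The real embedding `e₁ : K → ℝ`, `θ ↦ r₁`.** [folklore] -/
def e₁ : K →+* ℝ := AdjoinRoot.lift (algebraMap ℚ ℝ) r₁ (eval₂_cubicPolyRat_real r₁_spec.2)
/-- **The real embedding `e₂ : K → ℝ`, `θ ↦ r₂`.** [folklore] -/
def e₂ : K →+* ℝ := AdjoinRoot.lift (algebraMap ℚ ℝ) r₂ (eval₂_cubicPolyRat_real r₂_spec.2)
/-- **The real embedding `e₃ : K → ℝ`, `θ ↦ r₃`.** [folklore] -/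
def e₃ : K →+* ℝ := AdjoinRoot.lift (algebraMap ℚ ℝ) r₃ (eval₂_cubicPolyRat_real r₃_spec.2)

/-- `e₁ θ = r₁`. [folklore] -/
@[simp] theorem e₁_θ : e₁ θ = r₁ := AdjoinRoot.lift_root _
/-- `e₂ θ = r₂`. [folklore] -/
@[simp] theorem e₂_θ : e₂ θ = r₂ := AdjoinRoot.lift_root _
/-- `e₃ θ = r₃`. [folklore] -/
@[simp] theorem e₃_θ : e₃ θ = r₃ := AdjoinRoot.lift_root _

/-- A real embedding sends `ω` to `(e(θ)² - 1)/3`. [folklore] -/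
theorem emb_ω (e : K →+* ℝ) : e ω = ((e θ) ^ 2 - 1) / 3 := by
  rw [show ω = (θ ^ 2 - 1) / 3 from rfl, map_div₀, map_sub, map_pow, map_one, map_ofNat]

/-- The three real embeddings are pairwise distinct (they separate `θ`). [folklore] -/
theorem e_ne : e₁ ≠ e₂ ∧ e₁ ≠ e₃ ∧ e₂ ≠ e₃ := by
  have h1 := r₁_spec.1; have h2 := r₂_spec.1; have h3 := r₃_spec.1
  simp only [Set.mem_Ioo] at h1 h2 h3
  refine ⟨fun h => ?_, fun h => ?_, fun h => ?_⟩
  · have := congrArg (· θ) h; simp only [e₁_θ, e₂_θ] at this; linarith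
  · have := congrArg (· θ) h; simp only [e₁_θ, e₃_θ] at this; linarith
  · have := congrArg (· θ) h; simp only [e₂_θ, e₃_θ] at this; linarith

/-! ### Units modulo squares: `(𝓞 K)ˣ/(𝓞 K)ˣ² = {±u₁^i u₂^j}` via real signs -/

/-- For a cubic field the unit rank is at most `2`. [folklore] -/
theorem units_rank_le_two : Units.rank K ≤ 2 := by
  have h1 := InfinitePlace.card_add_two_mul_card_eq_rank K
  have h2 := InfinitePlace.card_eq_nrRealPlaces_add_nrComplexPlaces K
  rw [finrank_K] at h1
  rw [Units.rank, h2]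
  omega

/-- **Units modulo squares (Dirichlet)**, as in `CyclicCubic13.exists_rep_mul_sq`. [folklore] -/
theorem exists_rep_mul_sq (x : (𝓞 K)ˣ) :
    ∃ (s : Fin 2) (ε : Fin (Units.rank K) → Fin 2) (η : (𝓞 K)ˣ),
      x = ((-1) ^ (s : ℕ) * ∏ i, Units.fundSystem K i ^ ((ε i : ℕ))) * η ^ 2 := by
  classical
  obtain ⟨⟨ζ, e⟩, hx, -⟩ := Units.exist_unique_eq_mul_prod K x
  have hodd : Odd (Module.finrank ℚ K) := by rw [finrank_K]; decide
  refine ⟨if ((ζ : (𝓞 K)ˣ) = 1) then 0 else 1, fun i => ⟨(e i % 2).toNat, by omega⟩,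
    ∏ i, Units.fundSystem K i ^ (e i / 2), ?_⟩
  have hsplit : ∀ i, Units.fundSystem K i ^ e i =
      Units.fundSystem K i ^ (((⟨(e i % 2).toNat, by omega⟩ : Fin 2) : ℕ)) *
        (Units.fundSystem K i ^ (e i / 2)) ^ 2 := by
    intro i
    rw [← zpow_natCast, ← zpow_natCast (Units.fundSystem K i ^ (e i / 2)) 2, ← zpow_mul,
      ← zpow_add]
    congr 1
    push_cast
    rw [Int.toNat_of_nonneg (Int.emod_nonneg _ two_ne_zero)]
    omega
  rw [← Finset.prod_pow, mul_assoc, ← Finset.prod_mul_distrib]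
  simp_rw [← hsplit]
  rcases Units.torsion_eq_one_or_neg_one_of_odd_finrank hodd ζ with hζ | hζ
  · rw [if_pos hζ]
    simp only [Fin.val_zero, pow_zero, one_mul]
    rw [hζ, one_mul] at hx
    exact hx
  · have hne : (ζ : (𝓞 K)ˣ) ≠ 1 := by
      rw [hζ]
      intro h
      have h' := congrArg (fun u : (𝓞 K)ˣ => (u : 𝓞 K)) h
      simp only [Units.val_neg, Units.val_one] at h'
      norm_num at h'
    rw [if_neg hne]
    simp only [Fin.val_one, pow_one]
    rw [hζ] at hx
    exact hx

/-- The **sign vector** of a unit under the three real embeddings. [folklore] -/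
def sgn (y : (𝓞 K)ˣ) : SignType × SignType × SignType :=
  (SignType.sign (e₁ ((y : 𝓞 K) : K)), SignType.sign (e₂ ((y : 𝓞 K) : K)),
    SignType.sign (e₃ ((y : 𝓞 K) : K)))

/-- The sign vector is multiplicative. [folklore] -/
theorem sgn_mul (y z : (𝓞 K)ˣ) : sgn (y * z) = sgn y * sgn z := by
  simp only [sgn, Units.val_mul, map_mul, sign_mul, Prod.mk_mul_mk]

/-- A real embedding does not vanish on units. [folklore] -/
theorem emb_units_ne_zero (e : K →+* ℝ) (y : (𝓞 K)ˣ) : e ((y : 𝓞 K) : K) ≠ 0 :=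
  (map_ne_zero e).mpr (RingOfIntegers.coe_ne_zero_iff.mpr (Units.ne_zero y))

/-- Squares of units are totally positive: `sgn (η²) = 1`. [folklore] -/
theorem sgn_sq (η : (𝓞 K)ˣ) : sgn (η ^ 2) = 1 := by
  have h : ∀ e : K →+* ℝ, SignType.sign (e (((η ^ 2 : (𝓞 K)ˣ) : 𝓞 K) : K)) = 1 := fun e => by
    have hc : (((η ^ 2 : (𝓞 K)ˣ) : 𝓞 K) : K) = (((η : (𝓞 K)ˣ) : 𝓞 K) : K) ^ 2 := by
      rw [Units.val_pow_eq_pow_val]; push_cast; rfl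
    rw [hc, map_pow]
    exact sign_pos (lt_of_le_of_ne (sq_nonneg _) (Ne.symm (pow_ne_zero 2 (emb_units_ne_zero e η))))
  simp only [sgn, h]
  rfl

/-- `sgn(-1) = (-, -, -)`. [folklore] -/
theorem sgn_neg_one : sgn (-1) = (-1, -1, -1) := by
  have h : ∀ e : K →+* ℝ, SignType.sign (e (((-1 : (𝓞 K)ˣ) : 𝓞 K) : K)) = -1 := fun e => by
    rw [Units.val_neg, Units.val_one]
    push_cast
    rw [map_neg, map_one]
    exact sign_neg (by norm_num)
  simp only [sgn, h]

/-- The sign of `e(y)` equals the sign of `e(y⁻¹)` for a unit `y` (their product is `1 > 0`):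
this lets us read off a sign from whichever of `y`, `y⁻¹` is easier to bound. [folklore] -/
theorem sign_emb_eq_sign_emb_inv (e : K →+* ℝ) (y : (𝓞 K)ˣ) :
    SignType.sign (e ((y : 𝓞 K) : K)) = SignType.sign (e (((y⁻¹ : (𝓞 K)ˣ) : 𝓞 K) : K)) := by
  have hprod : e ((y : 𝓞 K) : K) * e (((y⁻¹ : (𝓞 K)ˣ) : 𝓞 K) : K) = 1 := by
    rw [← map_mul, ← map_mul, Units.mul_inv, map_one, map_one]
  rcases lt_or_gt_of_ne (emb_units_ne_zero e y) with h | h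
  · rw [sign_neg h, sign_neg]
    nlinarith [emb_units_ne_zero e y⁻¹]
  · rw [sign_pos h, sign_pos]
    nlinarith [emb_units_ne_zero e y⁻¹]

/-- The values of the real embeddings on `u₁`, `u₂` and their inverses as functions of the root
`r = e(θ)`. [folklore] -/
theorem emb_units (e : K →+* ℝ) :
    e (((unit₁ : (𝓞 K)ˣ) : 𝓞 K) : K) = 2 / 3 * (e θ) ^ 2 + 3 * e θ - 8 / 3 ∧
    e (((unit₁⁻¹ : (𝓞 K)ˣ) : 𝓞 K) : K) = -(19 / 3) * (e θ) ^ 2 + 27 * e θ + 220 / 3 ∧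
    e (((unit₂ : (𝓞 K)ˣ) : 𝓞 K) : K) = -(5 / 3) * (e θ) ^ 2 + 2 * e θ + 152 / 3 ∧
    e (((unit₂⁻¹ : (𝓞 K)ˣ) : 𝓞 K) : K) = -(8 / 3) * (e θ) ^ 2 - 19 * e θ - 79 / 3 := by
  simp only [coe_unit₁, coe_unit₁_inv, coe_unit₂, coe_unit₂_inv, map_add, map_sub, map_mul,
    map_neg, map_ofNat, coe_θint, coe_ωint, emb_ω]
  refine ⟨by ring, by ring, by ring, by ring⟩

/-- `sgn(u₁) = (-, -, +)`: at `r₁ ∈ (-6,-5)` via `u₁⁻¹`, at `r₂ ∈ (-2,-1)` and `r₃ ∈ (6,7)`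
directly. [folklore] -/
theorem sgn_unit₁ : sgn unit₁ = (-1, -1, 1) := by
  have h1 := r₁_spec.1; have h2 := r₂_spec.1; have h3 := r₃_spec.1
  simp only [Set.mem_Ioo] at h1 h2 h3
  obtain ⟨a1, b1, -, -⟩ := emb_units e₁
  obtain ⟨a2, -, -, -⟩ := emb_units e₂
  obtain ⟨a3, -, -, -⟩ := emb_units e₃
  simp only [e₁_θ, e₂_θ, e₃_θ] at a1 b1 a2 a3
  simp only [sgn]
  rw [sign_emb_eq_sign_emb_inv e₁, b1, a2, a3, sign_neg, sign_neg, sign_pos]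
  · nlinarith
  · nlinarith
  · nlinarith

/-- `sgn(u₂) = (-, +, -)`: at `r₁`, `r₂` directly, at `r₃` via `u₂⁻¹`. [folklore] -/
theorem sgn_unit₂ : sgn unit₂ = (-1, 1, -1) := by
  have h1 := r₁_spec.1; have h2 := r₂_spec.1; have h3 := r₃_spec.1
  simp only [Set.mem_Ioo] at h1 h2 h3
  obtain ⟨-, -, c1, -⟩ := emb_units e₁
  obtain ⟨-, -, c2, -⟩ := emb_units e₂
  obtain ⟨-, -, -, d3⟩ := emb_units e₃
  simp only [e₁_θ, e₂_θ, e₃_θ] at c1 c2 d3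
  simp only [sgn]
  rw [c1, c2, sign_emb_eq_sign_emb_inv e₃, d3, sign_neg, sign_pos, sign_neg]
  · nlinarith
  · nlinarith
  · nlinarith

/-- The eight representatives `±u₁^i u₂^j`, `i, j ∈ {0, 1}`. [folklore] -/
def rep (a i j : Fin 2) : (𝓞 K)ˣ := (-1) ^ (a : ℕ) * unit₁ ^ (i : ℕ) * unit₂ ^ (j : ℕ)

/-- The sign vectors of the eight representatives run through `{±1}³`. [folklore] -/
theorem sgn_rep (a i j : Fin 2) :
    sgn (rep a i j) = ((-1) ^ (a : ℕ) * (-1) ^ (i : ℕ) * (-1) ^ (j : ℕ),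
      (-1) ^ (a : ℕ) * (-1) ^ (i : ℕ), (-1) ^ (a : ℕ) * (-1) ^ (j : ℕ)) := by
  have hpow : ∀ (u : (𝓞 K)ˣ) (k : Fin 2), sgn (u ^ (k : ℕ)) = sgn u ^ (k : ℕ) := by
    intro u k
    fin_cases k
    · simp [sgn]
    · simp
  rw [rep, sgn_mul, sgn_mul, hpow, hpow, hpow, sgn_neg_one, sgn_unit₁, sgn_unit₂]
  fin_cases a <;> fin_cases i <;> fin_cases j <;> decide

/-- **A unit of trivial sign vector (totally positive) is a square** (the eight `±u₁^i u₂^j`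
realise all sign vectors and there are at most `8` classes modulo squares, so `sgn` is injective
modulo squares). [folklore] -/
theorem exists_sq_eq_of_sgn_eq_one (x : (𝓞 K)ˣ) (hx : sgn x = 1) : ∃ η : (𝓞 K)ˣ, x = η ^ 2 := by
  classical
  set F := Units.fundSystem K with hF
  let E := Fin 2 × (Fin (Units.rank K) → Fin 2)
  let ρ : E → (𝓞 K)ˣ := fun e => (-1) ^ (e.1 : ℕ) * ∏ i, F i ^ ((e.2 i : ℕ))
  have hρ0 : ρ (0, fun _ => 0) = 1 := by simp [ρ]
  have hcardE : Fintype.card E ≤ 8 := by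
    have hr := units_rank_le_two
    simp only [E, Fintype.card_prod, Fintype.card_fun, Fintype.card_fin]
    calc 2 * 2 ^ Units.rank K ≤ 2 * 2 ^ 2 :=
          Nat.mul_le_mul_left 2 (Nat.pow_le_pow_right (by norm_num) hr)
      _ = 8 := by norm_num
  let T : Finset (SignType × SignType × SignType) :=
    {(1, 1, 1), (1, 1, -1), (1, -1, 1), (1, -1, -1), (-1, 1, 1), (-1, 1, -1), (-1, -1, 1),
      (-1, -1, -1)}
  have hTcard : T.card = 8 := by decide
  have hred : ∀ y : (𝓞 K)ˣ, ∃ e : E, sgn y = sgn (ρ e) := by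
    intro y
    obtain ⟨s, ε, η, hy⟩ := exists_rep_mul_sq y
    exact ⟨(s, ε), by rw [hy, sgn_mul, sgn_sq, mul_one]⟩
  have hsurjT : T ⊆ Finset.univ.image (sgn ∘ ρ) := by
    intro v hv
    rw [Finset.mem_image]
    have hreal : ∃ y : (𝓞 K)ˣ, sgn y = v := by
      simp only [T, Finset.mem_insert, Finset.mem_singleton] at hv
      rcases hv with rfl | rfl | rfl | rfl | rfl | rfl | rfl | rfl
      · exact ⟨rep 0 0 0, by rw [sgn_rep]; decide⟩
      · exact ⟨rep 1 1 0, by rw [sgn_rep]; decide⟩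
      · exact ⟨rep 1 0 1, by rw [sgn_rep]; decide⟩
      · exact ⟨rep 0 1 1, by rw [sgn_rep]; decide⟩
      · exact ⟨rep 1 1 1, by rw [sgn_rep]; decide⟩
      · exact ⟨rep 0 0 1, by rw [sgn_rep]; decide⟩
      · exact ⟨rep 0 1 0, by rw [sgn_rep]; decide⟩
      · exact ⟨rep 1 0 0, by rw [sgn_rep]; decide⟩
    obtain ⟨y, hy⟩ := hreal
    obtain ⟨e, he⟩ := hred y
    exact ⟨e, Finset.mem_univ e, by rw [Function.comp_apply, ← he, hy]⟩
  have hinj : Set.InjOn (sgn ∘ ρ) (Finset.univ : Finset E) := by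
    rw [← Finset.card_image_iff]
    apply le_antisymm Finset.card_image_le
    calc (Finset.univ : Finset E).card = Fintype.card E := Finset.card_univ
      _ ≤ 8 := hcardE
      _ = T.card := hTcard.symm
      _ ≤ (Finset.univ.image (sgn ∘ ρ)).card := Finset.card_le_card hsurjT
  obtain ⟨s, ε, η, hxe⟩ := exists_rep_mul_sq x
  have hρe : sgn (ρ (s, ε)) = sgn (ρ (0, fun _ => 0)) := by
    rw [hρ0]
    have : sgn x = sgn (ρ (s, ε)) := by rw [hxe, sgn_mul, sgn_sq, mul_one]
    rw [← this, hx]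
    simp only [sgn, Units.val_one, map_one, sign_one]
    rfl
  have he0 : (s, ε) = (0, fun _ => 0) := hinj (Finset.mem_univ _) (Finset.mem_univ _) hρe
  refine ⟨η, ?_⟩
  rw [hxe, show ((-1) ^ (s : ℕ) * ∏ i, F i ^ ((ε i : ℕ)) : (𝓞 K)ˣ) = ρ (s, ε) from rfl, he0, hρ0,
    one_mul]

/-- Each coordinate of a sign vector of a unit is `±1`. [folklore] -/
theorem sgn_coord_cases (x : (𝓞 K)ˣ) (e : K →+* ℝ) :
    SignType.sign (e ((x : 𝓞 K) : K)) = 1 ∨ SignType.sign (e ((x : 𝓞 K) : K)) = -1 := by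
  rcases lt_or_gt_of_ne (emb_units_ne_zero e x) with h | h
  · exact Or.inr (sign_neg h)
  · exact Or.inl (sign_pos h)

/-- Group-theoretic bookkeeping: `x R = η²` gives `x = R (η R⁻¹)²`. [folklore] -/
theorem eq_mul_sq_of_mul_eq_sq {G : Type*} [CommGroup G] {x R η : G} (h : x * R = η ^ 2) :
    x = R * (η * R⁻¹) ^ 2 := by
  rw [mul_pow, inv_pow, ← h, ← mul_assoc, mul_comm R (x * R), mul_assoc x R R, ← pow_two,
    mul_inv_cancel_right]

/-- **Every unit of `K` is `±u₁^i u₂^j` times a square** (`i, j ∈ {0, 1}`). [folklore] -/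
theorem exists_eq_rep_mul_sq (x : (𝓞 K)ˣ) : ∃ (a i j : Fin 2) (η : (𝓞 K)ˣ), x = rep a i j * η ^ 2 := by
  obtain ⟨v, hv⟩ : ∃ v, sgn x = v := ⟨_, rfl⟩
  have hv1 : v.1 = 1 ∨ v.1 = -1 := by rw [← hv]; exact sgn_coord_cases x e₁
  have hv2 : v.2.1 = 1 ∨ v.2.1 = -1 := by rw [← hv]; exact sgn_coord_cases x e₂
  have hv3 : v.2.2 = 1 ∨ v.2.2 = -1 := by rw [← hv]; exact sgn_coord_cases x e₃
  obtain ⟨v₁, v₂, v₃⟩ := v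
  simp only at hv1 hv2 hv3
  have hR : ∃ a i j : Fin 2, sgn (rep a i j) = (v₁, v₂, v₃) ∧ sgn (x * rep a i j) = 1 := by
    simp_rw [sgn_mul, hv]
    rcases hv1 with rfl | rfl <;> rcases hv2 with rfl | rfl <;> rcases hv3 with rfl | rfl <;>
      first
      | exact ⟨0, 0, 0, by rw [sgn_rep]; decide⟩ | exact ⟨1, 1, 0, by rw [sgn_rep]; decide⟩
      | exact ⟨1, 0, 1, by rw [sgn_rep]; decide⟩ | exact ⟨0, 1, 1, by rw [sgn_rep]; decide⟩
      | exact ⟨1, 1, 1, by rw [sgn_rep]; decide⟩ | exact ⟨0, 0, 1, by rw [sgn_rep]; decide⟩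
      | exact ⟨0, 1, 0, by rw [sgn_rep]; decide⟩ | exact ⟨1, 0, 0, by rw [sgn_rep]; decide⟩
  obtain ⟨a, i, j, -, hsq⟩ := hR
  obtain ⟨η, hη⟩ := exists_sq_eq_of_sgn_eq_one _ hsq
  exact ⟨a, i, j, η * (rep a i j)⁻¹, eq_mul_sq_of_mul_eq_sq hη⟩

/-- **A totally positive unit of `K` is a square.** [folklore] -/
theorem exists_sq_eq_of_pos (x : (𝓞 K)ˣ) (h₁ : 0 < e₁ ((x : 𝓞 K) : K)) (h₂ : 0 < e₂ ((x : 𝓞 K) : K))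
    (h₃ : 0 < e₃ ((x : 𝓞 K) : K)) : ∃ η : (𝓞 K)ˣ, x = η ^ 2 :=
  exists_sq_eq_of_sgn_eq_one x (by simp only [sgn, sign_pos h₁, sign_pos h₂, sign_pos h₃]; rfl)

end CyclicCubic103

end Literature.NumberTheory.NumberFields

end
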